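import Summits.QuantumFields.YangMills.Theorems.BalabanUVNodesPortS1LZHalfRegL
import Summits.QuantumFields.YangMills.Theorems.BalabanUVNodesPortS1FEStepPieces

/-!
# NODE O port PT-A — ★★★ director-ym №637 (1)(b)(c) ∕ №639 (3): THE (P5)-CLASS LETTER IN ANTECEDENT FORM `RegClassP5` (carrier-free, `∃ εn γ′ > 0` AFTER the ⁸ antecedent, ◇ lens-1's S₂
# prefix∕tail shape) AND THE BRICK `lzHalfReg_of_P0C_of_classP2_of_regClass : (∀F, P0HolExtAtRecordGL F) → (∀F, ClassP2Reg F) → (∀F, RegClassP5 F) → (∀F, RegClassNestsUc F) → ∀F, PortRecordLZHalfReg F`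
# with the ⁸ binders THREADED into the two Reg letters (◆ C50 (R)); (t4) base point; the bridges from the antecedent-free letters

Cell `ym-nodeO-ideate`, porter seat PT-A-1 (gen 11); `--supports stmt-QuantumFields-27930 --as helper`; count-neutral; definition kind (§0 one `def … : Prop`) + theorems.
[I] = [Balaban1987RG1]; [16] = [Balaban1985UV3]; [15] = [Balaban1985Variational].

WHY.  №635 (t5) ∕ №636 (1) ∕ №637 (1): the class letters of the LZ side take the ANTECEDENT FORM (the class radius `εn` and the form constant `γ′` may depend on the ⁸ antecedent's data) and (P5) is NOT
merged with the nesting (S₂ = `RegClassNestsUc` is shared with the FE split and lives in ★★ DEF-1's hoist ✓`…PortS1FEStepPieces` :123).  This file: §0 `RegClassP5` = the (P5) conjuncts of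
✓`ClassP5NestReg` (✓`…ClassRegDefs` §3) MINUS `CutsInUc`, under the ⁸ antecedent with S₂'s tail `∀ ε₂₉ α₀ α₁ > 0, ∃ εn γ′ > 0, ∀ ε₀ ∈ (0, εn], ∀ k n B, InRegClass … ε₀ … B → PosDef T(B) ∧
⟨v, T(B)v⟩ ≤ γ′|v|²` (`T(B) = recordPreckLoc … a₀ (portVkAx … B) (hopLinGraph … (portVkAx … B))`, REAL matrix over `NonB0Idx`); §1 bridges from the antecedent-free letters (STRONGER ⟹ this) and
(t4); §2 the brick — the δ-Jacobian half UNCONDITIONAL (✓`lzjacResidueOnReg`), the Gaussian half by ✓`lzdetResidueOnReg_of_carriers_classP5Nest` at the class radius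
`min (min ε₂ ε₅) (min εN ε_cl)` with the Reg letters instantiated AT the antecedent's binders `(Mc, j, c, c₀, c₁, B₃, B₃′, a₀, a₁, hT8, hT9, hTE, hP9, hP9L)` and `(ε₂₉, α₀, α₁)`.
INTENDED SUPPLIER of `RegClassP5` (№633 (c)): the P0C ∕ P0-ℝ supplier — [15] Thm 1 (E2) positivity of the (2.11) Hessian at guarded real backgrounds + the P0-ℝ `C²` row at `V_B`
(✓`isHermitian_recordPreckLoc_of_small`) — the same critical path as `ClassP2Reg` and `stub_P0C`: ONE wall.
* §0 `RegClassP5` (def).  §1 `regClassP5_of_classP5NestReg`, `regClassP5_of_classP5Reg_of_P0C`-free note, ★ `regClassP5Body_zero_of_P0C` ((t4)).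
* §2 ★★★ `lzHalfReg_of_P0C_of_classP2_of_regClass`.

HONEST FRAMING.  One letter asserted for nothing + one `obtain` chain over DISPLAYED letters (`P0HolExtAtRecordGL`, `ClassP2Reg`, `RegClassP5`, `RegClassNestsUc` — inhabited NOWHERE) and the
tree's own theorems; `stub_LZhalfReg` is a theorem MODULO those four letters (v3.8's reading), the registry untouched by this file; nothing of Bałaban's RG estimates asserted, ported or discharged;
⟨27930⟩ OPEN · no claim; ⟨26900⟩ 0∕4; NODE O 0∕1; COUNT 8∕28 · K 1∕4 UNMOVED; finite `𝕋⁴_{L^K}` at fixed ε — NOT continuum ∕ OS; **the Yang–Mills mass gap (Clay) is NOT proved by any of this.**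
No `sorry`, no `instance`; standard axioms.
-/

noncomputable section

open scoped BigOperators Matrix.Norms.L2Operator Topology

namespace Summit.QuantumFields.YangMills.Theorems.BalabanUVNodesPortS1

open Summit.QuantumFields.YangMills.Theorems.K0RecordFormatNames
open Literature.MathematicalPhysics.QuantumFieldTheory.Balaban1983to89
open Literature.MathematicalPhysics.QuantumFieldTheory.Balaban1983to89.Node00
open Literature.MathematicalPhysics.QuantumFieldTheory.Balaban1983to89.T4Continuum (T4Family)
open Literature.MathematicalPhysics.QuantumFieldTheory.Balaban1983to89.B12TreeDecay (K₀ kappa₀)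
open _root_.Matrix _root_.Filter

/-! ## §0  The (P5)-class letter in antecedent form -/

/-- ★★ **`RegClassP5 F` — (P5) ON PRINT's ε₀-CLASS, ANTECEDENT FORM, CARRIER-FREE** (★★★ director-ym №637 (1)(b): the (P5) conjuncts of ✓`ClassP5NestReg` minus `CutsInUc`, under the ⁸
antecedent, in ◇ lens-1's S₂ prefix∕tail shape): under the signed antecedent of 27930⁸-Ax-LR4 (verbatim, as in ✓`RegClassNestsUc`), for every `(ε₂₉, α₀, α₁) > 0` there are ONE class radius
`εn > 0` and ONE form constant `γ′ > 0` — after the antecedent's data and `(ε₂₉, α₀, α₁)`, BEFORE `ε₀ ≤ εn`, the level `k`, the volume index `n` and the class point `B` — such that at every point of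
every ε₀-regular class with `ε₀ ≤ εn` the REAL (2.11) matrix over the non-`b₀` index `T(B) := recordPreckLoc … a₀ (portVkAx … B) (hopLinGraph … (portVkAx … B))` is positive definite with
`⟨v, T(B)v⟩ ≤ γ′|v|²` — print's (2.11)–(2.12) «on the spaces U_k(ε₀)» with [15] (E2)'s upper constant.  No carrier; no clause of `P0CarrierClauses`, (P2), `G3CPiecesAt`, `CutsInUc` or
`PortRecordLZHalfReg` inside.  The antecedent-free ✓`ClassP5NestReg` is STRONGER (`regClassP5_of_classP5NestReg`).  INTENDED SUPPLIER (№633 (c)): the P0C ∕ P0-ℝ supplier ([15] Thm 1 (E2) +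
the P0-ℝ `C²` row at guarded real backgrounds), on the same critical path as `ClassP2Reg` and `stub_P0C`.  A `Prop`; asserted for nothing; consumed by ★★★`lzHalfReg_of_P0C_of_classP2_of_regClass`.
[cite: Balaban1987RG1, (2.11)–(2.12) pp.267–268, (1.1)–(1.2) p.260, p.264 (Thm 3 «on the spaces U_k(ε₀)»); Balaban1985Variational, (117) p.295, Thm 1 p.279, Prop. 9 p.309] -/
def RegClassP5 (F : T4Family) : Prop :=
  ∃ Mth : ℕ, ∀ Mc : ℕ, Mth ≤ Mc → ∀ (j c c₀ c₁ : ℕ) (B₃ B₃' a₀ a₁ : ℝ), Summit.QuantumFields.YangMills.Theorems.K0RecordFormatNames.McGuard F Mc → c ≤ F.L ^ j → c₀ ≤ j + 1 → c₁ ≤ j → 2 * (F.L : ℝ) ^ 2 ≤ B₃ → 0 < B₃' → 0 < a₀ → 0 < a₁ → Literature.MathematicalPhysics.QuantumFieldTheory.Balaban1983to89.Node00.VariationalThm1RegSepCoP7MGB F 2 (fun ν M g K k _s => c ≤ ν.M₁ ∧ k + c₀ ≤ F.m + K ∧ F.L ^ c₁ ∣ M ∧ ∀ i, 1 ≤ i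 → i ≤ k → Literature.MathematicalPhysics.QuantumFieldTheory.Balaban1983to89.Node00.dCubeSide (F.P K).L M (Literature.MathematicalPhysics.QuantumFieldTheory.Balaban1983to89.Node00.RkOfRecord (F.P K).L ν.r (g i)) i ∣ (F.P K).sitesPerDir 0) (Literature.MathematicalPhysics.QuantumFieldTheory.Balaban1983to89.Node00.lamDatum F) (Literature.MathematicalPhysics.QuantumFieldTheory.Balaban1983to89.Node00.dataSmall7LamTopOf F 2) B₃ a₀ a₁ → Literature.MathematicalPhysics.QuantumFieldTheory.Balaban1983to89.Node00.Gauge9RegSepTopStepGB F 2 (fun ν K Ω => Literature.MathematicalPhysics.QuantumFieldTheory.Balaban1983to89.Node00.suppDomOfRecord F ν K Ω) (F.L ^ j) (fun ν M g K k _s => c ≤ ν.M₁ ∧ k + c₀ ≤ F.m + K ∧ F.L ^ c₁ ∣ M ∧ ∀ i, 1 ≤ i → i ≤ k → Literature.MathematicalPhysics.QuantumFieldTheory.Balaban1983to89.Node00.dCubeSide (F.P K).L M (Literature.MathematicalPhysics.QuantumFieldTheory.Balaban1983to89.Node00.RkOfRecord (F.P K).L ν.r (g i)) i ∣ (F.P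 K).sitesPerDir 0) (Literature.MathematicalPhysics.QuantumFieldTheory.Balaban1983to89.Node00.lamDatum F) (Literature.MathematicalPhysics.QuantumFieldTheory.Balaban1983to89.Node00.dataSmall7LamTopOf F 2) B₃ B₃' a₀ a₁ → (∀ ε₁ : ℝ, 0 < ε₁ → ε₁ ≤ a₁ → B₃ * ε₁ ≤ a₀ → ∀ (k n : ℕ) (V : Literature.MathematicalPhysics.QuantumFieldTheory.Balaban1983to89.GaugeField (F.P (Summit.QuantumFields.YangMills.Theorems.K0RecordFormatNames.recordK₀ F Mc k + n)) (k + 1) (Literature.MathematicalPhysics.QuantumFieldTheory.Balaban1983to89.Node00.SU 2)), Literature.MathematicalPhysics.QuantumFieldTheory.Balaban1983to89.PlaqSmall ε₁ V → Literature.MathematicalPhysics.QuantumFieldTheory.Balaban1983to89.Node00.UkExists F 2 (Summit.QuantumFields.YangMills.Theorems.K0RecordFormatNames.recordK₀ F Mc k + n) (k + 1) a₀ V ∧ Literature.MathematicalPhysics.QuantumFieldTheory.Balaban1983to89.Node00.UniqueUkOrbit F 2 (Summit.QuantumFields.YangMills.Theorems.K0RecordFormatNames.recordK₀ F Mc k +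 n) (k + 1) a₀ V) → (∀ (k n : ℕ) (ε₂₉ : ℝ), 0 < ε₂₉ → letI θ := Summit.QuantumFields.YangMills.Theorems.K0RecordFormatNames.thetaFill F a₀ ε₂₉; letI := θ.instVβ₁; letI := θ.instVβ₂; letI := θ.instιβ; AnalyticAt ℝ (fun B : Summit.QuantumFields.YangMills.Theorems.K0RecordFormatNames.recordW F a₀ ε₂₉ k (Summit.QuantumFields.YangMills.Theorems.K0RecordFormatNames.recordK₀ F Mc k + n) => fun (b : Literature.MathematicalPhysics.QuantumFieldTheory.Balaban1983to89.PBond (F.P (Summit.QuantumFields.YangMills.Theorems.K0RecordFormatNames.recordK₀ F Mc k + n)) 0) (i i' : Fin 2) => ((Summit.QuantumFields.YangMills.Theorems.K0RecordFormatNames.recordBgField F θ k (Summit.QuantumFields.YangMills.Theorems.K0RecordFormatNames.recordK₀ F Mc k + n) B b : Literature.MathematicalPhysics.QuantumFieldTheory.Balaban1983to89.Node00.SU 2) : Matrix (Fin 2) (Fin 2) ℂ) i i') 0) → (∃ C₉' δ₉ : ℝ, 0 ≤ C₉' ∧ 0 < δ₉ ∧ ∀ (k n : ℕ) (ε₂₉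 : ℝ), 0 < ε₂₉ → letI θ := Summit.QuantumFields.YangMills.Theorems.K0RecordFormatNames.thetaFill F a₀ ε₂₉; letI := θ.instVβ₁; letI := θ.instVβ₂; letI := θ.instιβ; ∀ (a : θ.ιβ) (μ : Fin (F.P (Summit.QuantumFields.YangMills.Theorems.K0RecordFormatNames.recordK₀ F Mc k + n)).d) (y : Literature.MathematicalPhysics.QuantumFieldTheory.Balaban1983to89.Site (F.P (Summit.QuantumFields.YangMills.Theorems.K0RecordFormatNames.recordK₀ F Mc k + n)) (k + 1)), letI D := fderiv ℝ (fun B : Summit.QuantumFields.YangMills.Theorems.K0RecordFormatNames.recordW F a₀ ε₂₉ k (Summit.QuantumFields.YangMills.Theorems.K0RecordFormatNames.recordK₀ F Mc k + n) => fun (b : Literature.MathematicalPhysics.QuantumFieldTheory.Balaban1983to89.PBond (F.P (Summit.QuantumFields.YangMills.Theorems.K0RecordFormatNames.recordK₀ F Mc k + n)) 0) (i i' : Fin 2) => ((Summit.QuantumFields.YangMills.Theorems.K0RecordFormatNames.recordBgField F θ k (Summit.QuantumFields.YangMills.Theorems.K0RecordFormatNames.recordK₀ F Mc k + n) B b : Literature.MathematicalPhysics.QuantumFieldTheory.Balaban1983to89.Node00.SU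 2) : Matrix (Fin 2) (Fin 2) ℂ) i i') 0 (Pi.single μ (Pi.single y (θ.bV a))); ∃ (Hr : Literature.MathematicalPhysics.QuantumFieldTheory.Balaban1983to89.PBond (F.P (Summit.QuantumFields.YangMills.Theorems.K0RecordFormatNames.recordK₀ F Mc k + n)) 0 → Fin 2 → Fin 2 → ℂ) (φ : Literature.MathematicalPhysics.QuantumFieldTheory.Balaban1983to89.Site (F.P (Summit.QuantumFields.YangMills.Theorems.K0RecordFormatNames.recordK₀ F Mc k + n)) 0 → Fin 2 → Fin 2 → ℂ), (∀ b : Literature.MathematicalPhysics.QuantumFieldTheory.Balaban1983to89.PBond (F.P (Summit.QuantumFields.YangMills.Theorems.K0RecordFormatNames.recordK₀ F Mc k + n)) 0, D b = Hr b + (φ b.src - φ (b.src.shift b.dir))) ∧ (∃ μc : Literature.MathematicalPhysics.QuantumFieldTheory.Balaban1983to89.Site (F.P (Summit.QuantumFields.YangMills.Theorems.K0RecordFormatNames.recordK₀ F Mc k + n)) (k + 1) → Fin 2 → Fin 2 → ℂ, ∀ x : Literature.MathematicalPhysics.QuantumFieldTheory.Balaban1983to89.Site (F.P (Summit.QuantumFields.YangMills.Theorems.K0RecordFormatNames.recordK₀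 F Mc k + n)) 0, letI dv := (fun x' : Literature.MathematicalPhysics.QuantumFieldTheory.Balaban1983to89.Site (F.P (Summit.QuantumFields.YangMills.Theorems.K0RecordFormatNames.recordK₀ F Mc k + n)) 0 => ∑ ν : Fin (F.P (Summit.QuantumFields.YangMills.Theorems.K0RecordFormatNames.recordK₀ F Mc k + n)).d, (Hr ⟨x', ν⟩ - Hr ⟨x'.unshift ν, ν⟩)); ∑ ν : Fin (F.P (Summit.QuantumFields.YangMills.Theorems.K0RecordFormatNames.recordK₀ F Mc k + n)).d, (dv (x.shift ν) - (2 : ℂ) • dv x + dv (x.unshift ν)) = μc (Summit.QuantumFields.YangMills.Theorems.K0RecordFormatNames.coarsenTo (k + 1) x)) ∧ ∀ b : Literature.MathematicalPhysics.QuantumFieldTheory.Balaban1983to89.PBond (F.P (Summit.QuantumFields.YangMills.Theorems.K0RecordFormatNames.recordK₀ F Mc k + n)) 0, ‖Hr b‖ ≤ C₉' * (F.P (Summit.QuantumFields.YangMills.Theorems.K0RecordFormatNames.recordK₀ F Mc k + n)).eta (k + 1) * Real.exp (-(δ₉ * (Literature.MathematicalPhysics.QuantumFieldTheory.Balaban1983to89.Site.tdist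 (Summit.QuantumFields.YangMills.Theorems.K0RecordFormatNames.coarsenTo (k + 1) b.src) y : ℝ))) ∧ (∀ ν : Fin (F.P (Summit.QuantumFields.YangMills.Theorems.K0RecordFormatNames.recordK₀ F Mc k + n)).d, ‖Hr (⟨b.src.shift ν, b.dir⟩ : Literature.MathematicalPhysics.QuantumFieldTheory.Balaban1983to89.PBond (F.P (Summit.QuantumFields.YangMills.Theorems.K0RecordFormatNames.recordK₀ F Mc k + n)) 0) - Hr b‖ ≤ C₉' * (F.P (Summit.QuantumFields.YangMills.Theorems.K0RecordFormatNames.recordK₀ F Mc k + n)).eta (k + 1) ^ 2 * Real.exp (-(δ₉ * (Literature.MathematicalPhysics.QuantumFieldTheory.Balaban1983to89.Site.tdist (Summit.QuantumFields.YangMills.Theorems.K0RecordFormatNames.coarsenTo (k + 1) b.src) y : ℝ)))) ∧ ‖∑ ν : Fin (F.P (Summit.QuantumFields.YangMills.Theorems.K0RecordFormatNames.recordK₀ F Mc k + n)).d, (Hr (⟨b.src.shift ν, b.dir⟩ : Literature.MathematicalPhysics.QuantumFieldTheory.Balaban1983to89.PBond (F.P (Summit.QuantumFields.YangMills.Theorems.K0RecordFormatNames.recordK₀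 F Mc k + n)) 0) - (2 : ℂ) • Hr b + Hr (⟨b.src.unshift ν, b.dir⟩ : Literature.MathematicalPhysics.QuantumFieldTheory.Balaban1983to89.PBond (F.P (Summit.QuantumFields.YangMills.Theorems.K0RecordFormatNames.recordK₀ F Mc k + n)) 0))‖ ≤ C₉' * (F.P (Summit.QuantumFields.YangMills.Theorems.K0RecordFormatNames.recordK₀ F Mc k + n)).eta (k + 1) ^ 3 * Real.exp (-(δ₉ * (Literature.MathematicalPhysics.QuantumFieldTheory.Balaban1983to89.Site.tdist (Summit.QuantumFields.YangMills.Theorems.K0RecordFormatNames.coarsenTo (k + 1) b.src) y : ℝ))) ∧ ‖∑ ν : Fin (F.P (Summit.QuantumFields.YangMills.Theorems.K0RecordFormatNames.recordK₀ F Mc k + n)).d, ((Hr (⟨b.src, b.dir⟩ : Literature.MathematicalPhysics.QuantumFieldTheory.Balaban1983to89.PBond (F.P (Summit.QuantumFields.YangMills.Theorems.K0RecordFormatNames.recordK₀ F Mc k + n)) 0) + Hr (⟨(b.src).shift b.dir, ν⟩ : Literature.MathematicalPhysics.QuantumFieldTheory.Balaban1983to89.PBond (F.P (Summit.QuantumFields.YangMills.Theorems.K0RecordFormatNames.recordK₀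 F Mc k + n)) 0) - Hr (⟨(b.src).shift ν, b.dir⟩ : Literature.MathematicalPhysics.QuantumFieldTheory.Balaban1983to89.PBond (F.P (Summit.QuantumFields.YangMills.Theorems.K0RecordFormatNames.recordK₀ F Mc k + n)) 0) - Hr (⟨b.src, ν⟩ : Literature.MathematicalPhysics.QuantumFieldTheory.Balaban1983to89.PBond (F.P (Summit.QuantumFields.YangMills.Theorems.K0RecordFormatNames.recordK₀ F Mc k + n)) 0)) - (Hr (⟨b.src.unshift ν, b.dir⟩ : Literature.MathematicalPhysics.QuantumFieldTheory.Balaban1983to89.PBond (F.P (Summit.QuantumFields.YangMills.Theorems.K0RecordFormatNames.recordK₀ F Mc k + n)) 0) + Hr (⟨(b.src.unshift ν).shift b.dir, ν⟩ : Literature.MathematicalPhysics.QuantumFieldTheory.Balaban1983to89.PBond (F.P (Summit.QuantumFields.YangMills.Theorems.K0RecordFormatNames.recordK₀ F Mc k + n)) 0) - Hr (⟨(b.src.unshift ν).shift ν, b.dir⟩ : Literature.MathematicalPhysics.QuantumFieldTheory.Balaban1983to89.PBond (F.P (Summit.QuantumFields.YangMills.Theorems.K0RecordFormatNames.recordK₀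 F Mc k + n)) 0) - Hr (⟨b.src.unshift ν, ν⟩ : Literature.MathematicalPhysics.QuantumFieldTheory.Balaban1983to89.PBond (F.P (Summit.QuantumFields.YangMills.Theorems.K0RecordFormatNames.recordK₀ F Mc k + n)) 0)))‖ ≤ C₉' * (F.P (Summit.QuantumFields.YangMills.Theorems.K0RecordFormatNames.recordK₀ F Mc k + n)).eta (k + 1) ^ 3 * Real.exp (-(δ₉ * (Literature.MathematicalPhysics.QuantumFieldTheory.Balaban1983to89.Site.tdist (Summit.QuantumFields.YangMills.Theorems.K0RecordFormatNames.coarsenTo (k + 1) b.src) y : ℝ)))) → ∀ (ε₂₉ α₀ α₁ : ℝ), 0 < ε₂₉ → 0 < α₀ → 0 < α₁ → ∃ εn γ' : ℝ, 0 < εn ∧ 0 < γ' ∧ ∀ ε₀ : ℝ, 0 < ε₀ → ε₀ ≤ εn → ∀ (k n : ℕ) (B : Summit.QuantumFields.YangMills.Theorems.K0RecordFormatNames.recordW F a₀ ε₂₉ k (Summit.QuantumFields.YangMills.Theorems.K0RecordFormatNames.recordK₀ F Mc k + n)), Summit.QuantumFields.YangMills.Theorems.K0RecordFormatNames.InRegClass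 F Mc k ε₀ a₀ ε₂₉ n B →
      (recordPreckLoc F k (recordK₀ F Mc k + n) a₀ (portVkAx F a₀ ε₂₉ k (recordK₀ F Mc k + n) B)
          (hopLinGraph F k (recordK₀ F Mc k + n) (portVkAx F a₀ ε₂₉ k (recordK₀ F Mc k + n) B))).PosDef ∧
      ∀ v : NonB0Idx F k (recordK₀ F Mc k + n) → ℝ,
        dotProduct v (Matrix.mulVec (recordPreckLoc F k (recordK₀ F Mc k + n) a₀ (portVkAx F a₀ ε₂₉ k (recordK₀ F Mc k + n) B)
            (hopLinGraph F k (recordK₀ F Mc k + n) (portVkAx F a₀ ε₂₉ k (recordK₀ F Mc k + n) B))) v) ≤ γ' * dotProduct v v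

/-! ## §1  Bridges from the antecedent-free letters; (t4) at the base point -/

/-- **The antecedent-free letter is STRONGER**: `ClassP5NestReg F → RegClassP5 F` (its `ε₀, γ′` do not read the antecedent; every `ε₀' ≤ ε₀` is served by ✓`inRegClass_mono`; the nesting conjunct is
dropped). [cite: Balaban1987RG1, (2.11) p.267, (1.1)–(1.2) p.260 (bookkeeping)] -/
theorem regClassP5_of_classP5NestReg {F : T4Family} (h : ClassP5NestReg F) : RegClassP5 F := by
  refine ⟨0, fun Mc _ j c c₀ c₁ B₃ B₃' a₀ a₁ hG _ _ _ _ _ h₆ _ _ _ _ _ _ ε₂₉ α₀ α₁ hε hα₀ hα₁ => ?_⟩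
  obtain ⟨εn, γ', hεn, hγ', H⟩ := h Mc a₀ ε₂₉ α₀ α₁ hG h₆ hε hα₀ hα₁
  exact ⟨εn, γ', hεn, hγ', fun ε₀ _ hle k n B hB => ⟨(H k n B (inRegClass_mono hle hB)).1, (H k n B (inRegClass_mono hle hB)).2.1⟩⟩

/-- ★ **(◆ C34 (t4)) THE BODY OF `RegClassP5` AT THE BASE POINT IS A THEOREM** for every carrier family with the P0-ℂ body, with `γ′ := γ₁`: `PosDef T(0) ∧ ⟨v, T(0)v⟩ ≤ γ₁|v|²` —
(P5) of `P0CarrierClauses` at the base point of its own germ (✓`classP5NestBody_zero_of_P0C`, first two conjuncts); `0 ∈` every class (✓`inRegClass_zero`). [cite: Balaban1987RG1, (2.11)–(2.12) pp.267–268] -/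
theorem regClassP5Body_zero_of_P0C (F : T4Family) {Mc : ℕ} {a₀ δ₀ c₀ γ₀ γ₁ α₀ α₁ ε₂₉ : ℝ} {k : ℕ} (hα₀ : 0 < α₀) (hα₁ : 0 < α₁)
    {TC : (n : ℕ) → Sect2.CPair (F.P (recordK₀ F Mc k + n)) (MatA 2) → FluctIdx F k (recordK₀ F Mc k + n) → FluctIdx F k (recordK₀ F Mc k + n) → ℂ}
    {TY : (n : ℕ) → (recordDomSys F Mc k (recordK₀ F Mc k + n)).Dom → Sect2.CPair (F.P (recordK₀ F Mc k + n)) (MatA 2) →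
        FluctIdx F k (recordK₀ F Mc k + n) → FluctIdx F k (recordK₀ F Mc k + n) → ℂ}
    {TZY : Finset (Fin 4 → ℤ) → IntBondCfg → ((Fin 4 → ℤ) × Fin 4) × Fin 3 → ((Fin 4 → ℤ) × Fin 4) × Fin 3 → ℂ}
    {AdM : (n : ℕ) → (Site (F.P (recordK₀ F Mc k + n)) 0 → (MatA 2)ˣ) → Matrix (FluctIdx F k (recordK₀ F Mc k + n)) (FluctIdx F k (recordK₀ F Mc k + n)) ℂ}
    {AdZ : ((Fin 4 → ℤ) → (MatA 2)ˣ) → (Fin 4 → ℤ) × Fin 4 → Matrix (Fin 3) (Fin 3) ℂ}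
    (hP : P0CarrierClauses F a₀ δ₀ c₀ γ₀ γ₁ Mc α₀ α₁ ε₂₉ k TC TY TZY AdM AdZ) (n : ℕ) :
    letI θ := thetaFill F a₀ ε₂₉; letI := θ.instVβ₁; letI := θ.instVβ₂; letI := θ.instιβ
    (recordPreckLoc F k (recordK₀ F Mc k + n) a₀ (portVkAx F a₀ ε₂₉ k (recordK₀ F Mc k + n) 0)
        (hopLinGraph F k (recordK₀ F Mc k + n) (portVkAx F a₀ ε₂₉ k (recordK₀ F Mc k + n) 0))).PosDef ∧
    ∀ v : NonB0Idx F k (recordK₀ F Mc k + n) → ℝ,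
      dotProduct v (Matrix.mulVec (recordPreckLoc F k (recordK₀ F Mc k + n) a₀ (portVkAx F a₀ ε₂₉ k (recordK₀ F Mc k + n) 0)
          (hopLinGraph F k (recordK₀ F Mc k + n) (portVkAx F a₀ ε₂₉ k (recordK₀ F Mc k + n) 0))) v) ≤ γ₁ * dotProduct v v :=
  ⟨(classP5NestBody_zero_of_P0C F hα₀ hα₁ hP n).1, (classP5NestBody_zero_of_P0C F hα₀ hα₁ hP n).2.1⟩

/-! ## §2  ★★★ The brick with the ⁸ binders threaded into the Reg letters -/

/-- ★★★ **`lzHalfReg_of_P0C_of_classP2_of_regClass`** (★★★ director-ym №637 (1)(c) ∕ №639 (3)(c)): `(∀F, P0HolExtAtRecordGL F) → (∀F, ClassP2Reg F) → (∀F, RegClassP5 F) →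
(∀F, RegClassNestsUc F) → ∀F, PortRecordLZHalfReg F` — v3.7∕v3.8's `stub_LZhalfReg` type from `stub_P0C`'s letter, the (P2)-class letter and the two antecedent-form class letters, the ⁸
binders `(Mc, j, c, c₀, c₁, B₃, B₃′, a₀, a₁, McGuard, …, hT8, hT9, hTE, hP9, hP9L)` and `(ε₂₉, α₀, α₁)` THREADED into `RegClassP5` ∕ `RegClassNestsUc` (◆ C50 (R)); the δ-Jacobian half
UNCONDITIONAL (✓`lzjacResidueOnReg`); the Gaussian half by ✓`lzdetResidueOnReg_of_carriers_classP5Nest` at the class radius `min (min ε₂ ε₅) (min εN ε_cl)`, the (63) radius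
`R := max (2γ′) (16c₀·64K₀·e^{δ₀})`; `phiLZ = phiLZjac + phiLZdet`, radii∕rates∕class radii by `min`, constants added.
[cite: Balaban1987RG1, (1.4) p.260, (1.6)–(1.7) p.261, (1.18)–(1.19) p.263, (1.21) p.264, (2.11)–(2.12) pp.267–268, (1.1)–(1.2) p.260, p.263 L5–13; Balaban1985UV3, (63) p.272, (23)–(25) p.262;
Balaban1985Variational, Thm 1 p.279, Prop. 9 p.309] -/
theorem lzHalfReg_of_P0C_of_classP2_of_regClass (hP : ∀ F, P0HolExtAtRecordGL F) (hC2 : ∀ F, ClassP2Reg F) (hC5 : ∀ F, RegClassP5 F) (hN : ∀ F, RegClassNestsUc F) :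
    ∀ F, PortRecordLZHalfReg F := by
  intro F
  obtain ⟨M₁, H₁⟩ := lzjacResidueOnReg F
  -- the Gaussian half's outer constants (as in ✓`lzdetResidueOnRegL`)
  obtain ⟨c₀, γ₀, γ₁, δ₁, hc₀, hγ₀, hγ, hδ₁, HP⟩ := hP F
  have hκ₈0 : 0 ≤ kappa₀ (4 * 2 ^ 4) (2 * 4) := B12TreeDecay.kappa₀_nonneg (by norm_num) _
  have hκt0 : 0 < 4 * kappa₀ (4 * 2 ^ 4) (2 * 4) + 2 := by positivity
  obtain ⟨δG, hδG, Mth', HG⟩ := g3cPiecesAt_pointwise F (4 * kappa₀ (4 * 2 ^ 4) (2 * 4) + 2) hκt0 c₀ γ₀ γ₁ δ₁ hc₀ hγ₀ hγ hδ₁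
  obtain ⟨δ₀, hδ₀G, hδ₀8⟩ : ∃ δ₀ : ℝ, δG ≤ δ₀ ∧ 8 * kappa₀ (4 * 2 ^ 4) (2 * 4) + 4 ≤ δ₀ := ⟨max δG _, le_max_left _ _, le_max_right _ _⟩
  have hδ₀pos : 0 < δ₀ := hδG.trans_le hδ₀G
  obtain ⟨Mth, HM⟩ := HP δ₀ hδ₀pos
  obtain ⟨M₅, H5⟩ := hC5 F
  obtain ⟨MN, HN⟩ := hN F
  refine ⟨max (max M₁ (max Mth Mth')) (max M₅ MN), fun Mc hMc j c cc₀ c₁ B₃ B₃' a₀ a₁ hGuard h₁ h₂ h₃ hB₃ h₅ ha₀ ha₁ hT8 hT9 hUk hP9 hP9L ε₂₉ hε => ?_⟩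
  have hM₁ : M₁ ≤ Mc := (le_max_left _ _).trans ((le_max_left _ _).trans hMc)
  have hMth : Mth ≤ Mc := (le_max_left _ _).trans ((le_max_right _ _).trans ((le_max_left _ _).trans hMc))
  have hMth' : Mth' ≤ Mc := (le_max_right _ _).trans ((le_max_right _ _).trans ((le_max_left _ _).trans hMc))
  have hM5 : M₅ ≤ Mc := (le_max_left _ _).trans ((le_max_right _ _).trans hMc)
  have hMN : MN ≤ Mc := (le_max_right _ _).trans ((le_max_right _ _).trans hMc)
  -- THE δ-JACOBIAN HALF (unconditional)
  obtain ⟨E₁, κ₁, α₀', α₁', δ₁', hE₁, hκ₁, hα₀', hα₁', hδ₁', HJ⟩ := H₁ Mc hM₁ hGuard B₃ a₀ a₁ hB₃ ha₀ ha₁ hUk ε₂₉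
  -- THE GAUSSIAN HALF (walk of ✓`lzdetResidueOnRegL` with the Reg letters at the antecedent's binders)
  obtain ⟨Bc, hBc, HB⟩ := HG δ₀ hδ₀G Mc hMth' hGuard
  have hB₃pos : 0 < B₃ := by
    have hL : (1 : ℝ) ≤ F.L := by exact_mod_cast F.hL.2.le
    nlinarith
  set ε₁ : ℝ := min a₁ (a₀ / B₃) with hε₁def
  have hε₁ : 0 < ε₁ := lt_min ha₁ (div_pos ha₀ hB₃pos)
  have hTokE := hUk ε₁ hε₁ (min_le_left _ _) (by
    calc B₃ * min a₁ (a₀ / B₃) ≤ B₃ * (a₀ / B₃) := mul_le_mul_of_nonneg_left (min_le_right _ _) hB₃pos.le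
      _ = a₀ := by field_simp)
  obtain ⟨α₀, α₁, hα₀, hα₁, HK⟩ := HM Mc hMth hGuard a₀ ha₀ ⟨_, hε₁, hTokE⟩
  -- the class radii: (P2)-class (antecedent-free), (P5)-class and the nesting IN ANTECEDENT FORM (binders threaded), the twins' radius
  obtain ⟨ε₂, hε₂, HC2⟩ := hC2 F Mc a₀ ε₂₉ δ₀ c₀ γ₀ γ₁ α₀ α₁ hGuard ha₀ hε
  obtain ⟨ε₅, γ', hε₅, hγ', HC5⟩ := H5 Mc hM5 j c cc₀ c₁ B₃ B₃' a₀ a₁ hGuard h₁ h₂ h₃ hB₃ h₅ ha₀ ha₁ hT8 hT9 hUk hP9 hP9L ε₂₉ α₀ α₁ hε hα₀ hα₁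
  obtain ⟨εN, hεN, HNN⟩ := HN Mc hMN j c cc₀ c₁ B₃ B₃' a₀ a₁ hGuard h₁ h₂ h₃ hB₃ h₅ ha₀ ha₁ hT8 hT9 hUk hP9 hP9L ε₂₉ α₀ α₁ hε hα₀ hα₁
  set εcl : ℝ := min (ε₁ / 2) (1 / (53581824 * (F.L : ℝ) ^ 6)) with hεcldef
  have hLpos : (0 : ℝ) < F.L := by exact_mod_cast F.hL.2.le.trans_lt' (by norm_num)
  have hεcl : 0 < εcl := lt_min (half_pos hε₁) (by positivity)
  set δcls : ℝ := min (min ε₂ ε₅) (min εN εcl) with hδclsdef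
  have hδcls : 0 < δcls := lt_min (lt_min hε₂ hε₅) (lt_min hεN hεcl)
  have hδ2 : δcls ≤ ε₂ := (min_le_left _ _).trans (min_le_left _ _)
  have hδ5 : δcls ≤ ε₅ := (min_le_left _ _).trans (min_le_right _ _)
  have hδN : δcls ≤ εN := (min_le_right _ _).trans (min_le_left _ _)
  have hδcl : δcls ≤ εcl := (min_le_right _ _).trans (min_le_right _ _)
  have hδclsc : δcls ≤ 1 / (53581824 * (F.L : ℝ) ^ 6) := hδcl.trans (min_le_right _ _)
  have hδclsε : 2 * δcls ≤ ε₁ := by have := hδcl.trans (min_le_left _ _); linarith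
  -- the radius of [16] (63), with the letter's form constant
  obtain ⟨R, hR₁, hRc⟩ : ∃ R : ℝ, 2 * γ' ≤ R ∧ 2 * ((2 * c₀) * (4 * 2 ^ 4 * K₀ (4 * 2 ^ 4) (2 * 4)) * Real.exp δ₀) ≤ R :=
    ⟨max _ _, le_max_left _ _, le_max_right _ _⟩
  have hR : 0 < R := lt_of_lt_of_le (by positivity) hR₁
  have hδ : kappa₀ (4 * 2 ^ 4) (2 * 4) ≤ δ₀ / 2 - 1 := by
    set κ₈ := kappa₀ (4 * 2 ^ 4) (2 * 4) with hκ₈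
    linarith
  have hκ₂ : 4 * kappa₀ (4 * 2 ^ 4) (2 * 4) ≤ min (4 * kappa₀ (4 * 2 ^ 4) (2 * 4) + 2) (δ₀ / 2) - 2 := by
    have h2 : 4 * kappa₀ (4 * 2 ^ 4) (2 * 4) + 2 ≤ δ₀ / 2 := by
      set κ₈ := kappa₀ (4 * 2 ^ 4) (2 * 4) with hκ₈
      linarith
    have h3 : 4 * kappa₀ (4 * 2 ^ 4) (2 * 4) + 2 ≤ min (4 * kappa₀ (4 * 2 ^ 4) (2 * 4) + 2) (δ₀ / 2) := le_min le_rfl h2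
    set κ₈ := kappa₀ (4 * 2 ^ 4) (2 * 4) with hκ₈
    set m := min (4 * κ₈ + 2) (δ₀ / 2) with hm
    linarith
  have HD : ∀ k : ℕ, ∃ (Ψ : IntLocalFormula (F.L ^ (k + 1) * Mc)) (Ew : TorusPieces F Mc k),
      Ψ.ResidueOnRegAtW F Mc k Ew a₀ ε₂₉ α₀ α₁ δcls (2 * (13 * 4 ^ 4 * (R * Bc + ((3 * 4 * (F.L * Mc) ^ 4 : ℕ) : ℝ)))) (min (4 * kappa₀ (4 * 2 ^ 4) (2 * 4) + 2) (δ₀ / 2) - 2)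
        (phiLZdet F Mc a₀ ε₂₉ k) := by
    intro k
    obtain ⟨TC, TY, TZY, AdM, AdZ, hPC, hLat⟩ := HK ε₂₉ hε k
    obtain ⟨EG, EGZ, hG3, hg1pt⟩ := HB a₀ α₀ α₁ ε₂₉ ha₀ hα₀ hα₁ hε k TC TY TZY AdM AdZ hPC hLat
    obtain ⟨ΨP, hΨP⟩ := stub_LZdetTwin F Mc hGuard a₀ δ₀ c₀ γ₀ γ₁ α₀ α₁ ε₂₉ k TC TY TZY AdM AdZ hPC R
    exact lzdetResidueOnReg_of_carriers_classP5Nest F hGuard k ha₀ hα₀ hα₁ hc₀ hγ' hBc hR hR₁ hδ hRc hδcls hδclsc hδclsε (hTokE k)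
      TC TY TZY AdM AdZ hPC EG EGZ hG3 hg1pt ΨP hΨP
      (fun n B hB => HC2 k TC TY TZY AdM AdZ hPC n B (inRegClass_mono hδ2 hB))
      (fun n B hB => HC5 δcls hδcls hδ5 k n B hB)
      (fun n B hB => HNN δcls hδcls hδN k n B hB)
  -- COMBINE the two halves: radii, rates, class radii by `min`, constants added
  have hE₂ : (0 : ℝ) ≤ 2 * (13 * 4 ^ 4 * (R * Bc + ((3 * 4 * (F.L * Mc) ^ 4 : ℕ) : ℝ))) := by positivity
  refine ⟨E₁ + 2 * (13 * 4 ^ 4 * (R * Bc + ((3 * 4 * (F.L * Mc) ^ 4 : ℕ) : ℝ))), min κ₁ (min (4 * kappa₀ (4 * 2 ^ 4) (2 * 4) + 2) (δ₀ / 2) - 2),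
    min α₀' α₀, min α₁' α₁, min δ₁' δcls, add_nonneg hE₁ hE₂, le_min hκ₁ hκ₂, lt_min hα₀' hα₀, lt_min hα₁' hα₁, lt_min hδ₁' hδcls, fun k => ?_⟩
  obtain ⟨Ψ₁, Ew₁, hR₁'⟩ := HJ k
  obtain ⟨Ψ₂, Ew₂, hR₂'⟩ := HD k
  have h := residueOnRegAtW_add F Ψ₁ Ψ₂ Ew₁ Ew₂ a₀ ε₂₉ (min α₀' α₀) (min α₁' α₁) (min δ₁' δcls) E₁ (2 * (13 * 4 ^ 4 * (R * Bc + ((3 * 4 * (F.L * Mc) ^ 4 : ℕ) : ℝ))))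
    (min κ₁ (min (4 * kappa₀ (4 * 2 ^ 4) (2 * 4) + 2) (δ₀ / 2) - 2)) (phiLZjac F Mc a₀ ε₂₉ k) (phiLZdet F Mc a₀ ε₂₉ k)
    (residueOnRegAtW_anti_eps (residueOnRegAtW_anti_radii (residueOnRegAtW_mono hR₁' le_rfl (min_le_left _ _) hE₁) (min_le_left _ _) (min_le_left _ _)) (min_le_left _ _))
    (residueOnRegAtW_anti_eps (residueOnRegAtW_anti_radii (residueOnRegAtW_mono hR₂' le_rfl (min_le_right _ _) hE₂) (min_le_right _ _) (min_le_right _ _)) (min_le_right _ _))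
  refine ⟨Ψ₁.add Ψ₂, fun n X φ => Ew₁ n X φ + Ew₂ n X φ, h.1, h.2.1, h.2.2.1, h.2.2.2.1, h.2.2.2.2.1, h.2.2.2.2.2.1, ?_⟩
  exact representsOnRegW_congr F _ _ a₀ ε₂₉ (min δ₁' δcls) (phiLZ F Mc a₀ ε₂₉ k) (fun n B => phiLZjac F Mc a₀ ε₂₉ k n B + phiLZdet F Mc a₀ ε₂₉ k n B)
    (fun n B => phiLZjac_add_phiLZdet F Mc a₀ ε₂₉ k n B) h.2.2.2.2.2.2

end Summit.QuantumFields.YangMills.Theorems.BalabanUVNodesPortS1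

end
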